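import Literature.NumberTheory.GaloisRepresentations.ContinuousCupProductCompat
import HarnessLib

/-!
# Mixed-variance naturality of the continuous cup product: `H²(γ)(H¹(α) a ∪₁ b) = a ∪₂ H¹(β) b` when
# `γ⟨α x, y⟩₁ = ⟨x, β y⟩₂` — the «projection formula» across levels (input M2 of the Cassels-via-Poitou–Tate plan for K4)

Crux K4 `SignedControlAtTwo` (stmt-BirchSwinnertonDyer-20309), line `eulerchar` v8; width seat `prover-bsd-wall-tp2-p3-w3` g4. Context:
`Cruxes/SignedControlAtTwo/CASSELS-VIA-PT-PLAN.md` §4. In the reduction of Cassels' theorem (Greenberg Prop. 4.13 special case) to the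
single-level existence half of Poitou–Tate, the obstruction `∑_v inv_v^{(N)}(t_v ∪ y_v)` is killed term by term by moving to a LOWER level
`e`: for `y` valued in `Ann(ker π) ≅ Hom(M_e, μ_e)`, `inv^{(N)}(t ∪_N κ ỹ) = inv^{(N)}(ι_* (π_* t ∪_e ỹ))`, `π : M_N ↠ M_e` multiplication by
`p^{N-e}`, `κ : Hom(M_e, μ_e) → Hom(M_N, μ_N)`, `ỹ ↦ ι ∘ ỹ ∘ π`, `ι : μ_e ⊆ μ_N`. The cohomological content is a naturality of the cup product
which is CONTRAVARIANT in the first variable and covariant in the second and in the target — the sibling of the tree's `ContPairing.cupProduct_map`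
(all covariant) and `ContPairing.cupProduct_adjoint` (same target). This file proves it for continuous cohomology of any topological group:

* `ContPairing.cupCocycle_map_adjoint` — cocycle level: `γ ∘ ((α ∘ f) ∪₁ g) = f ∪₂ (β ∘ g)`;
* `ContPairing.cupProduct_map_adjoint` — `H²(γ)(H¹(α) a ∪₁ b) = a ∪₂ H¹(β) b`.
* `ContPairing.cupCocycle_map_adjoint'` / `ContPairing.cupProduct_map_adjoint'` (appended, cell `pub/bsd-print-x9`, Howard H.4
  descent input (Adj)) — the mirror form `H²(γ)(a ∪₁ H¹(β) b) = H¹(α) a ∪₂ b` when `γ⟨x, β y⟩₁ = ⟨α x, y⟩₂`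
  (`α : X₁ → X₂`, `β : Y₂ → Y₁`).

THEOREMS ONLY (no definition, no named fact, no `sorry`); pure algebra; BSD is not proved by any of this.

References: [NeukirchSchmidtWingberg2008] J. Neukirch, A. Schmidt, K. Wingberg, *Cohomology of Number Fields*, I §4 (1.4.2)–(1.4.4)
(functoriality of the cup product; the projection formula `cor(a ∪ res b) = cor a ∪ b` is the same computation).
-/

set_option autoImplicit false

noncomputable section

open CategoryTheory Function

universe u v

namespace Literature.NumberTheory.GaloisRepresentations

open _root_.TopRep _root_.ContRepresentation _root_.ContinuousCohomology

namespace ContPairing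

variable {R : Type u} [CommRing R] [TopologicalSpace R]
variable {G : Type v} [Group G] [TopologicalSpace G] [IsTopologicalGroup G] [LocallyCompactSpace G]
variable {X₁ Y₁ Z₁ X₂ Y₂ Z₂ : TopRep.{v} R G}

omit [LocallyCompactSpace G] in
/-- Mixed-variance naturality of the cup-product cocycle: if `γ⟨α x, y⟩₁ = ⟨x, β y⟩₂` for `α : X₂ → X₁`, `β : Y₁ → Y₂`, `γ : Z₁ → Z₂`,
then `γ ∘ ((α ∘ f) ∪₁ g) = f ∪₂ (β ∘ g)`. [cite: NeukirchSchmidtWingberg2008, I §4 (1.4.2)] -/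
theorem cupCocycle_map_adjoint (P₁ : ContPairing X₁ Y₁ Z₁) (P₂ : ContPairing X₂ Y₂ Z₂)
    (α : X₂ ⟶ X₁) (β : Y₁ ⟶ Y₂) (γ : Z₁ ⟶ Z₂)
    (hc : ∀ x y, γ.hom (P₁.toLin (α.hom x) y) = P₂.toLin x (β.hom y))
    (f : contOneCocycles X₂) (g : contOneCocycles Y₁) :
    contTwoCocycles.pullback (ContinuousMonoidHom.id G) (resIdHom γ)
        (P₁.cupCocycle (contOneCocycles.pullback (ContinuousMonoidHom.id G) (resIdHom α) f) g) =
      P₂.cupCocycle f (contOneCocycles.pullback (ContinuousMonoidHom.id G) (resIdHom β) g) := by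
  refine Subtype.ext (ContinuousMap.ext fun p => ?_)
  obtain ⟨σ, τ⟩ := p
  rw [pullback₂_id_resIdHom_apply, cupCocycle_apply, cupCocycle_apply, pullback_id_resIdHom_apply, hc,
    pullback_id_resIdHom_apply, pullback_id_resIdHom_apply, map_sub]

/-- **Mixed-variance naturality of the cup product («projection formula»)**: if `γ⟨α x, y⟩₁ = ⟨x, β y⟩₂` for `α : X₂ → X₁`,
`β : Y₁ → Y₂`, `γ : Z₁ → Z₂`, then `H²(γ)(H¹(α) a ∪₁ b) = a ∪₂ H¹(β) b` for `a ∈ H¹(G, X₂)`, `b ∈ H¹(G, Y₁)`.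
[cite: NeukirchSchmidtWingberg2008, I §4 (1.4.2)] -/
theorem cupProduct_map_adjoint (P₁ : ContPairing X₁ Y₁ Z₁) (P₂ : ContPairing X₂ Y₂ Z₂)
    (α : X₂ ⟶ X₁) (β : Y₁ ⟶ Y₂) (γ : Z₁ ⟶ Z₂)
    (hc : ∀ x y, γ.hom (P₁.toLin (α.hom x) y) = P₂.toLin x (β.hom y))
    (a : continuousCohomology 1 X₂) (b : continuousCohomology 1 Y₁) :
    cohomologyMap γ 2 (P₁.cupProduct (cohomologyMap α 1 a) b) = P₂.cupProduct a (cohomologyMap β 1 b) := by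
  obtain ⟨f, rfl⟩ := oneCocycleClass_surjective _ a
  obtain ⟨g, rfl⟩ := oneCocycleClass_surjective _ b
  rw [cohomologyMap_oneCocycleClass, cupProduct_oneCocycleClass_eq_twoCocycleClass, cohomologyMap_twoCocycleClass,
    cupCocycle_map_adjoint P₁ P₂ α β γ hc, cohomologyMap_oneCocycleClass, cupProduct_oneCocycleClass_eq_twoCocycleClass]

omit [LocallyCompactSpace G] in
/-- Mixed-variance naturality of the cup-product cocycle, mirror form: if `γ⟨x, β y⟩₁ = ⟨α x, y⟩₂` for `α : X₁ → X₂`,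
`β : Y₂ → Y₁`, `γ : Z₁ → Z₂`, then `γ ∘ (f ∪₁ (β ∘ g)) = (α ∘ f) ∪₂ g`. [cite: NeukirchSchmidtWingberg2008, I §4 (1.4.2)] -/
theorem cupCocycle_map_adjoint' (P₁ : ContPairing X₁ Y₁ Z₁) (P₂ : ContPairing X₂ Y₂ Z₂)
    (α : X₁ ⟶ X₂) (β : Y₂ ⟶ Y₁) (γ : Z₁ ⟶ Z₂)
    (hc : ∀ x y, γ.hom (P₁.toLin x (β.hom y)) = P₂.toLin (α.hom x) y)
    (f : contOneCocycles X₁) (g : contOneCocycles Y₂) :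
    contTwoCocycles.pullback (ContinuousMonoidHom.id G) (resIdHom γ)
        (P₁.cupCocycle f (contOneCocycles.pullback (ContinuousMonoidHom.id G) (resIdHom β) g)) =
      P₂.cupCocycle (contOneCocycles.pullback (ContinuousMonoidHom.id G) (resIdHom α) f) g := by
  refine Subtype.ext (ContinuousMap.ext fun p => ?_)
  obtain ⟨σ, τ⟩ := p
  rw [pullback₂_id_resIdHom_apply, cupCocycle_apply, cupCocycle_apply, pullback_id_resIdHom_apply,
    pullback_id_resIdHom_apply, pullback_id_resIdHom_apply, ← map_sub, hc]

/-- **Mixed-variance naturality of the cup product, mirror form («projection formula» with the contravariant map on the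
second factor)**: if `γ⟨x, β y⟩₁ = ⟨α x, y⟩₂` for `α : X₁ → X₂`, `β : Y₂ → Y₁`, `γ : Z₁ → Z₂`, then
`H²(γ)(a ∪₁ H¹(β) b) = H¹(α) a ∪₂ b` for `a ∈ H¹(G, X₁)`, `b ∈ H¹(G, Y₂)`. [cite: NeukirchSchmidtWingberg2008, I §4 (1.4.2)] -/
theorem cupProduct_map_adjoint' (P₁ : ContPairing X₁ Y₁ Z₁) (P₂ : ContPairing X₂ Y₂ Z₂)
    (α : X₁ ⟶ X₂) (β : Y₂ ⟶ Y₁) (γ : Z₁ ⟶ Z₂)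
    (hc : ∀ x y, γ.hom (P₁.toLin x (β.hom y)) = P₂.toLin (α.hom x) y)
    (a : continuousCohomology 1 X₁) (b : continuousCohomology 1 Y₂) :
    cohomologyMap γ 2 (P₁.cupProduct a (cohomologyMap β 1 b)) = P₂.cupProduct (cohomologyMap α 1 a) b := by
  obtain ⟨f, rfl⟩ := oneCocycleClass_surjective _ a
  obtain ⟨g, rfl⟩ := oneCocycleClass_surjective _ b
  rw [cohomologyMap_oneCocycleClass, cupProduct_oneCocycleClass_eq_twoCocycleClass, cohomologyMap_twoCocycleClass,
    cupCocycle_map_adjoint' P₁ P₂ α β γ hc, cohomologyMap_oneCocycleClass, cupProduct_oneCocycleClass_eq_twoCocycleClass]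

end ContPairing

end Literature.NumberTheory.GaloisRepresentations

end
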